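import Summits.RiemannHypothesis.RiemannHypothesis.Theorems.TiltedLandingLaw421R3NewtonDoor2

open Complex Set
open scoped ComplexConjugate
open Literature.Analysis.Complex
open Summit.RiemannHypothesis.RiemannHypothesis.Theorems.Splittings.JensenWindow
open RhIdea6.G17.W07C7 RhIdea6.G17.W07C7.Rev6 RhIdea6.G18.W07C8.Law421BirthS RhIdea6.G19.W07C11.Seam
open RhIdea6.G20.W07C12.Frac RhIdea6.G20.W07C12.StColP RhW07.C12.FieldSplit RhIdea6.G21.W07C13.TentMax
open RhW07.C14.TwoSided RhW07.C14.Classes RhW07.C14.Lineage RhW07.C14.Booking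
open RhW07.C13.Heredity RhIdea6.G22.W07C15pre.Injection RhW07.E3.Cell RhW07.E3.Lit
open RhW08.Round1 RhW08.StSwap RhW08.Round2 RhW08.QuadW RhW08.SealSwapQ RhW08.SuccB RhW08.SuccSplit RhW08.SuccTheft
open RhW08.Column RhW08.Hurwitz
open RhW08.ClusterQ RhW08.ClusterQM

/-!
# W-08 NewtonDoor Part 3/4 — Proviso removal through assembly

Split from `NewtonDoor-W08-C1-rh-idea-5-g28.lean` (v17 ad5354c4).
-/

namespace RhW08.NewtonDoor

/-! ## Removing the proviso `F z ≠ 0` (zeros are isolated; continuity) -/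

/-- REMOVAL OF THE PROVISO: `F` analytic on `‖z − c‖ ≤ R` with `F c ≠ 0`, `g` continuous on the open ball `‖z − c‖ < r` (`r ≤ R`) and
`‖g z‖ ≤ ε` at the points of that ball where `F z ≠ 0` ⇒ `‖g‖ ≤ ε` on the whole open ball.  (With `g = G′/G` and `farField_bound_of_ne_zero`
this gives the far-field bound on every closed ball inside `‖z − c‖ < r`, as `lipschitz_of_bounded_holo` wants.) -/
theorem bound_of_bound_off_zeros {F g : ℂ → ℂ} {c : ℂ} {r R ε : ℝ} (hrR : r ≤ R) (hF : AnalyticOnNhd ℂ F (Metric.closedBall c R))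
    (hc : F c ≠ 0) (hg : ContinuousOn g (Metric.ball c r)) (hb : ∀ z ∈ Metric.ball c r, F z ≠ 0 → ‖g z‖ ≤ ε) :
    ∀ z ∈ Metric.ball c r, ‖g z‖ ≤ ε := by
  intro z hz
  by_cases hFz : F z ≠ 0
  · exact hb z hz hFz
  push Not at hFz
  have hzR : z ∈ Metric.closedBall c R := Metric.closedBall_subset_closedBall hrR (Metric.ball_subset_closedBall hz)
  -- F is not identically zero near z
  have hne : ∀ᶠ w in nhdsWithin z {z}ᶜ, F w ≠ 0 := by
    rcases (hF z hzR).eventually_eq_zero_or_eventually_ne_zero with h | h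
    · exfalso
      have hEq := hF.eqOn_zero_of_preconnected_of_eventuallyEq_zero (convex_closedBall c R).isPreconnected hzR h
      exact hc (hEq (Metric.mem_closedBall_self (le_trans (le_of_lt (lt_of_le_of_lt dist_nonneg (Metric.mem_ball.1 hz))) hrR)))
    · exact h
  -- points of the punctured neighbourhood inside the ball satisfy the bound
  have hin : ∀ᶠ w in nhdsWithin z {z}ᶜ, w ∈ Metric.ball c r :=
    Filter.Eventually.filter_mono nhdsWithin_le_nhds (Metric.isOpen_ball.mem_nhds hz)
  have hev : ∀ᶠ w in nhdsWithin z {z}ᶜ, ‖g w‖ ≤ ε := by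
    filter_upwards [hne, hin] with w hw1 hw2
    exact hb w hw2 hw1
  -- continuity of ‖g‖ at z
  have hcont : Filter.Tendsto (fun w => ‖g w‖) (nhdsWithin z {z}ᶜ) (nhds ‖g z‖) :=
    ((hg.continuousAt (Metric.isOpen_ball.mem_nhds hz)).norm.tendsto).mono_left nhdsWithin_le_nhds
  exact le_of_tendsto hcont hev

/-! ## The local factorisation AT the zero `v` itself (so that the canonical field `K = h′(v)/h(v)` splits as `N(v) + G′/G(v)`) -/

/-- PEEL-OFF AT `v`: under the hypotheses of `dslope_local_factor` at the point `z = v` (with `U ∈ 𝓝 v`), plus continuity of `h` and `G` at `v`,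
the identity `h = (∏_{u ∈ S \ {v}}(· − u)^{D u})·G` holds on a full neighbourhood of `v` (punctured identity + uniqueness of limits). Hence the
canonical Newton-door field `K := h′(v)/h(v)` equals `Σ_{u ≠ v} D_u/(v − u) + G′(v)/G(v)` by `field_split` — the `hK` of `lipschitz_of_near_far`. -/
theorem dslope_local_factor_at {F h G : ℂ → ℂ} (S : Finset ℂ) (D : ℂ → ℕ) {v : ℂ} {U : Set ℂ} (hU : U ∈ nhds v)
    (hfac : ∀ w ∈ U, F w = (∏ u ∈ S, (w - u) ^ (D u)) * G w) (hv : v ∈ S) (hDv : D v = 1)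
    (hF : ∀ w, F w = (w - v) * h w) (hh : ContinuousAt h v) (hG : ContinuousAt G v) :
    ∀ᶠ w in nhds v, h w = (∏ u ∈ S.erase v, (w - u) ^ (D u)) * G w := by
  classical
  -- the punctured identity, pointwise
  have hpt : ∀ w ∈ U, w ≠ v → h w = (∏ u ∈ S.erase v, (w - u) ^ (D u)) * G w := by
    intro w hwU hwv
    have hwv' : (w - v) ≠ 0 := sub_ne_zero.mpr hwv
    have hsplit : (∏ u ∈ S, (w - u) ^ (D u)) = (w - v) * ∏ u ∈ S.erase v, (w - u) ^ (D u) := by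
      rw [← Finset.mul_prod_erase S (fun u => (w - u) ^ (D u)) hv, hDv, pow_one]
    have key : (w - v) * h w = (w - v) * ((∏ u ∈ S.erase v, (w - u) ^ (D u)) * G w) := by
      rw [← hF w, hfac w hwU, hsplit, mul_assoc]
    exact mul_left_cancel₀ hwv' key
  -- the identity at v by uniqueness of limits along the punctured neighbourhood
  have hP : ContinuousAt (fun w : ℂ => ∏ u ∈ S.erase v, (w - u) ^ (D u)) v := by
    have : Differentiable ℂ (fun w : ℂ => ∏ u ∈ S.erase v, (w - u) ^ (D u)) := by fun_prop
    exact (this v).continuousAt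
  have hR : ContinuousAt (fun w : ℂ => (∏ u ∈ S.erase v, (w - u) ^ (D u)) * G w) v := hP.mul hG
  have hev : ∀ᶠ w in nhdsWithin v {v}ᶜ, h w = (∏ u ∈ S.erase v, (w - u) ^ (D u)) * G w := by
    have h1 : ∀ᶠ w in nhdsWithin v {v}ᶜ, w ∈ U := Filter.Eventually.filter_mono nhdsWithin_le_nhds (Filter.eventually_of_mem hU fun w hw => hw)
    have h2 : ∀ᶠ w in nhdsWithin v {v}ᶜ, w ≠ v := eventually_mem_nhdsWithin
    filter_upwards [h1, h2] with w hw1 hw2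
    exact hpt w hw1 hw2
  have hval : h v = (∏ u ∈ S.erase v, (v - u) ^ (D u)) * G v :=
    tendsto_nhds_unique_of_eventuallyEq (hh.tendsto.mono_left nhdsWithin_le_nhds) (hR.tendsto.mono_left nhdsWithin_le_nhds) hev
  -- assemble on the full neighbourhood
  filter_upwards [Filter.eventually_of_mem hU fun w hw => hw] with w hwU
  by_cases hwv : w = v
  · rw [hwv]; exact hval
  · exact hpt w hwU hwv

/-- COFACTOR LOCAL FACTORISATION, WITH THE CANONICAL FIELD AT `v`: as `cofactor_local_factor`, plus — for `v` in the OPEN big ball and `h` continuous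
at `v` (e.g. `h = dslope F v`, differentiable) — the identity `h = (∏_{S∖{v}}(· − u)^{D u})·G` near `v` and the SPLIT OF THE CANONICAL FIELD
`h′(v)/h(v) = Σ_{u ∈ S∖{v}} D_u/(v − u) + G′(v)/G(v)` (the `hK` of `lipschitz_of_near_far` with `K := h′(v)/h(v)`). -/
theorem cofactor_local_factor_at {F h : ℂ → ℂ} {c v : ℂ} {R₂ R : ℝ} (hR₂ : 0 < R₂) (hR : R₂ ≤ R)
    (hF : AnalyticOnNhd ℂ F (Metric.closedBall c R)) (hc : F c ≠ 0) (hv : v ∈ Metric.closedBall c R₂) (hvR : v ∈ Metric.ball c R)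
    (hord : analyticOrderAt F v = 1) (hFh : ∀ w, F w = (w - v) * h w) (hh : ContinuousAt h v) :
    ∃ G : ℂ → ℂ, AnalyticOnNhd ℂ G (Metric.closedBall c R) ∧ (∀ z ∈ Metric.closedBall c R₂, G z ≠ 0) ∧
      (∀ u ∈ nearSet F c R₂, u ∈ Metric.closedBall c R₂) ∧ (∀ u ∈ nearSet F c R₂, F u = 0) ∧ v ∈ nearSet F c R₂ ∧ nearMult F c R₂ v = 1 ∧
      (∀ z ∈ Metric.closedBall c R, F z = (∏ u ∈ nearSet F c R₂, (z - u) ^ (nearMult F c R₂ u)) * G z) ∧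
      (∀ z ∈ Metric.ball c R, z ≠ v → ∀ᶠ w in nhds z, h w = (∏ u ∈ (nearSet F c R₂).erase v, (w - u) ^ (nearMult F c R₂ u)) * G w) ∧
      (∀ᶠ w in nhds v, h w = (∏ u ∈ (nearSet F c R₂).erase v, (w - u) ^ (nearMult F c R₂ u)) * G w) ∧
      deriv h v / h v = ∑ u ∈ (nearSet F c R₂).erase v, ((nearMult F c R₂ u : ℕ) : ℂ) / (v - u) + deriv G v / G v := by
  obtain ⟨G, hG, hG0, hS, hFS, hvS, hDv, hfac, hloc⟩ := cofactor_local_factor hR₂ hR hF hc hv hord hFh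
  have hGv : AnalyticAt ℂ G v := hG v (Metric.ball_subset_closedBall hvR)
  have hat : ∀ᶠ w in nhds v, h w = (∏ u ∈ (nearSet F c R₂).erase v, (w - u) ^ (nearMult F c R₂ u)) * G w :=
    dslope_local_factor_at (nearSet F c R₂) (nearMult F c R₂) (Metric.isOpen_ball.mem_nhds hvR)
      (fun w hw => hfac w (Metric.ball_subset_closedBall hw)) hvS hDv hFh hh hGv.continuousAt
  refine ⟨G, hG, hG0, hS, hFS, hvS, hDv, hfac, hloc, hat, ?_⟩
  exact field_split ((nearSet F c R₂).erase v) (nearMult F c R₂) (fun a ha => (Finset.ne_of_mem_erase ha).symm) hGv.differentiableAt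
    (hG0 v hv) hat

/-! ## ASSEMBLY (analytic form): the Lipschitz bound on the Newton circle from Landau-disc data, canonical field `K = h′(v)/h(v)` -/

/-- THE FIELD BOUND ON THE NEWTON CIRCLE, ASSEMBLED.  Data: `F` analytic on `‖z − c‖ ≤ Rb` with `F c ≠ 0`, `|F| ≤ Bd` there; radii
`0 < r < r₁ < R₂ < Rb`; `v` a SIMPLE zero of `F` in the inner ball `‖z − c‖ ≤ R₂`; `F = (· − v)·h` with `h` continuous at `v`, differentiable on and
ZERO-FREE on the closed Newton disc `‖z − (v − K⁻¹)‖ ≤ ρ₀/‖K‖` (`ρ₀ ≠ 1`, so the circle misses `v`), `K := h′(v)/h(v) ≠ 0`; a Lipschitz ball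
`‖z − (v − K⁻¹)‖ ≤ rL` containing the circle and `v`, whose `δ`-collar lies inside the open Landau ball `‖z − c‖ < r`; the zeros of `F` in the inner
ball other than `v` are `≥ d > r_N := (1+ρ₀)/‖K‖` away from `v`; their total multiplicity (divisor mass of the inner ball) is `≤ Nb`; and `ε ≥` the
Landau constant.  THEN on the Newton circle `‖h′/h(z) − K‖ ≤ r_N·Nb/((d − r_N)d) + (ε/δ)·r_N` — the `hlip` of `succ_of_newton_door_lip`. -/
theorem lipschitz_on_newton_circle {F h : ℂ → ℂ} {c v K : ℂ} {r r₁ R₂ Rb Bd ρ₀ rL δ d Nb ε : ℝ}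
    (hr : 0 < r) (hr₁ : r < r₁) (hR₂ : r₁ < R₂) (hRb : R₂ < Rb)
    (hF : AnalyticOnNhd ℂ F (Metric.closedBall c Rb)) (hc : F c ≠ 0) (hBd : ∀ z ∈ Metric.closedBall c Rb, ‖F z‖ ≤ Bd)
    (hvin : v ∈ Metric.closedBall c R₂) (hord : analyticOrderAt F v = 1) (hFh : ∀ w, F w = (w - v) * h w) (hh : ContinuousAt h v)
    (hKdef : K = deriv h v / h v) (hK : K ≠ 0) (hρ1 : ρ₀ ≠ 1)
    (hh0 : ∀ z : ℂ, ‖z - (v - K⁻¹)‖ ≤ ρ₀ / ‖K‖ → h z ≠ 0)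
    (hδ : 0 < δ) (hrL1 : 1 / ‖K‖ ≤ rL) (hrL2 : ρ₀ / ‖K‖ ≤ rL)
    (hcont : Metric.closedBall (v - K⁻¹) (rL + δ) ⊆ Metric.ball c r)
    (hiso : ∀ u ∈ Metric.closedBall c R₂, F u = 0 → u ≠ v → d ≤ ‖v - u‖) (hd : (1 + ρ₀) / ‖K‖ < d)
    (hNb : (∑ u ∈ nearSet F c R₂, ((MeromorphicOn.divisor F (Metric.closedBall c R₂)) u : ℝ)) ≤ Nb)
    (hε : 2 * r₁ / ((R₂ - r₁) * (r₁ - r)) * (Real.log (Bd / ‖F c‖) + Nb * Real.log (Rb / (Rb - R₂)) + 1) ≤ ε) :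
    ∀ z : ℂ, ‖z - (v - K⁻¹)‖ = ρ₀ / ‖K‖ →
      ‖deriv h z / h z - K‖ ≤ (1 + ρ₀) / ‖K‖ * (Nb / ((d - (1 + ρ₀) / ‖K‖) * d)) + ε / δ * ((1 + ρ₀) / ‖K‖) := by
  classical
  -- radii and positivity
  have hR₂0 : 0 < R₂ := hr.trans (hr₁.trans hR₂)
  have hRb0 : 0 < Rb := hR₂0.trans hRb
  have hKn : 0 < ‖K‖ := norm_pos_iff.mpr hK
  have hvRb : v ∈ Metric.ball c Rb := by
    have : dist v c ≤ R₂ := hvin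
    rw [Metric.mem_ball]; linarith
  have hballr : Metric.ball c r ⊆ Metric.closedBall c r := Metric.ball_subset_closedBall
  have hballR₂ : Metric.ball c r ⊆ Metric.closedBall c R₂ := fun w hw => by
    have : dist w c < r := hw
    rw [Metric.mem_closedBall]; linarith
  have hballRb : Metric.ball c r ⊆ Metric.ball c Rb := Metric.ball_subset_ball (by linarith)
  -- the factorisation with the canonical field
  obtain ⟨G, hG, hG0, hS, hFS, hvS, hDv, hfac, hloc, _hat, hKsplit⟩ :=
    cofactor_local_factor_at hR₂0 hRb.le hF hc hvin hvRb hord hFh hh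
  set S := nearSet F c R₂ with hSdef
  set D := nearMult F c R₂ with hDdef
  set Dv := MeromorphicOn.divisor F (Metric.closedBall c R₂) with hDvdef
  have hF₂ : AnalyticOnNhd ℂ F (Metric.closedBall c R₂) := hF.mono (Metric.closedBall_subset_closedBall hRb.le)
  have hD0 : ∀ u, 0 ≤ Dv u := fun u => (MeromorphicOn.AnalyticOnNhd.divisor_nonneg hF₂) u
  have hDcast : ∀ u, ((D u : ℕ) : ℝ) = (Dv u : ℝ) := by
    intro u
    show (((Dv u).toNat : ℕ) : ℝ) = ((Dv u : ℤ) : ℝ)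
    rw [← Int.cast_natCast, Int.toNat_of_nonneg (hD0 u)]
  -- G analytic and logDeriv G differentiable on the Landau ball
  have hGan : ∀ w ∈ Metric.ball c r, AnalyticAt ℂ G w := fun w hw => hG w (Metric.ball_subset_closedBall (hballRb hw))
  have hgd : ∀ w ∈ Metric.ball c r, DifferentiableAt ℂ (logDeriv G) w := by
    intro w hw
    have e : logDeriv G = fun w => deriv G w / G w := funext fun w => logDeriv_apply G w
    rw [e]
    exact (hGan w hw).deriv.differentiableAt.div (hGan w hw).differentiableAt (hG0 w (hballR₂ hw))
  -- the Landau constant is ≤ ε (monotone in the divisor mass) and ε ≥ 0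
  have hlogR : 0 ≤ Real.log (Rb / (Rb - R₂)) := by
    apply Real.log_nonneg
    rw [le_div_iff₀ (by linarith)]; linarith
  have hcoef : 0 ≤ 2 * r₁ / ((R₂ - r₁) * (r₁ - r)) := by
    apply div_nonneg (by linarith)
    exact mul_nonneg (by linarith) (by linarith)
  have hlogB : 0 ≤ Real.log (Bd / ‖F c‖) := by
    apply Real.log_nonneg
    rw [le_div_iff₀ (norm_pos_iff.mpr hc)]
    simpa using hBd c (Metric.mem_closedBall_self hRb0.le)
  have hsumnn : 0 ≤ ∑ u ∈ S, (Dv u : ℝ) := Finset.sum_nonneg fun u _ => by exact_mod_cast hD0 u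
  have hLandau_le : 2 * r₁ / ((R₂ - r₁) * (r₁ - r)) * (Real.log (Bd / ‖F c‖) + (∑ u ∈ S, (Dv u : ℝ)) * Real.log (Rb / (Rb - R₂)) + 1) ≤ ε := by
    refine le_trans ?_ hε
    apply mul_le_mul_of_nonneg_left _ hcoef
    have := mul_le_mul_of_nonneg_right hNb hlogR
    linarith
  have hε0 : 0 ≤ ε := by
    refine le_trans ?_ hLandau_le
    apply mul_nonneg hcoef
    have : 0 ≤ (∑ u ∈ S, (Dv u : ℝ)) * Real.log (Rb / (Rb - R₂)) := mul_nonneg hsumnn hlogR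
    linarith
  -- the far-field bound on the whole open Landau ball
  have hfar : ∀ w ∈ Metric.ball c r, ‖logDeriv G w‖ ≤ ε := by
    refine bound_of_bound_off_zeros (le_of_lt (by linarith : r < Rb)) hF hc (fun w hw => (hgd w hw).continuousAt.continuousWithinAt) ?_
    intro w hw hFw
    exact le_trans (farField_bound_of_ne_zero hr hr₁ hR₂ hRb hF hc hBd hG hG0 hfac (hballr hw) hFw) hLandau_le
  -- the Lipschitz ball and its collar
  have hLr : Metric.closedBall (v - K⁻¹) rL ⊆ Metric.ball c r := fun w hw =>
    hcont (Metric.closedBall_subset_closedBall (by linarith) hw)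
  have hglip : ∀ z ∈ Metric.closedBall (v - K⁻¹) rL, ‖logDeriv G z - logDeriv G v‖ ≤ ε / δ * ‖z - v‖ := by
    intro z hz
    have hvL : v ∈ Metric.closedBall (v - K⁻¹) rL := by
      rw [Metric.mem_closedBall, dist_eq_norm, show v - (v - K⁻¹) = K⁻¹ by ring, norm_inv]
      simpa [one_div] using hrL1
    exact lipschitz_of_bounded_holo hδ (fun w hw => (hgd w (hcont hw)).differentiableWithinAt) (fun w hw => hfar w (hcont hw)) hz hvL
  -- now the circle
  intro z hz
  have hzv : z ≠ v := by
    intro hzv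
    rw [hzv, show v - (v - K⁻¹) = K⁻¹ by ring, norm_inv] at hz
    field_simp at hz
    exact hρ1 (by linarith)
  have hzL : z ∈ Metric.closedBall (v - K⁻¹) rL := by
    rw [Metric.mem_closedBall, dist_eq_norm]; exact le_of_eq_of_le hz hrL2
  have hzr : z ∈ Metric.ball c r := hLr hzL
  have hGz : G z ≠ 0 := hG0 z (hballR₂ hzr)
  have hhz : h z ≠ 0 := hh0 z (le_of_eq hz)
  have hFz : F z ≠ 0 := by rw [hFh z]; exact mul_ne_zero (sub_ne_zero.mpr hzv) hhz
  have hzS : ∀ a ∈ S.erase v, z ≠ a := fun a ha hza => hFz (hza ▸ hFS a (Finset.mem_of_mem_erase ha))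
  -- near identity at z
  have hq : deriv h z / h z = ∑ u ∈ S.erase v, ((D u : ℕ) : ℂ) / (z - u) + deriv G z / G z :=
    field_split (S.erase v) D hzS (hGan z hzr).differentiableAt hGz (hloc z (hballRb hzr) hzv)
  -- isolation of the other near zeros
  have hiso' : ∀ a ∈ S.erase v, d ≤ ‖v - a‖ := fun a ha =>
    hiso a (hS a (Finset.mem_of_mem_erase ha)) (hFS a (Finset.mem_of_mem_erase ha)) (Finset.ne_of_mem_erase ha)
  -- distance from v on the circle
  have hzvr : ‖z - v‖ ≤ (1 + ρ₀) / ‖K‖ := norm_sub_le_of_newtonDisc hK (le_of_eq hz)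
  -- apply the near/far Lipschitz assembly
  have hcastC : ∀ u, (((D u : ℕ) : ℝ) : ℂ) = ((D u : ℕ) : ℂ) := fun u => by push_cast; rfl
  have hq' : deriv h z / h z = ∑ u ∈ S.erase v, ((((D u : ℕ) : ℝ)) : ℂ) / (z - u) + logDeriv G z := by
    rw [hq, logDeriv_apply]
    congr 1
  have hK' : K = ∑ u ∈ S.erase v, ((((D u : ℕ) : ℝ)) : ℂ) / (v - u) + logDeriv G v := by
    rw [hKdef, hKsplit, logDeriv_apply]
    congr 1
  have hmain := lipschitz_of_near_far (S.erase v) (fun u => ((D u : ℕ) : ℝ)) (fun a _ => Nat.cast_nonneg _)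
    hzvr hd hiso' (div_nonneg hε0 hδ.le) (hglip z hzL) hq' hK'
  -- compare the near mass with Nb
  have hdpos : 0 < d := lt_of_le_of_lt (le_trans (norm_nonneg _) hzvr) hd
  have hden : 0 < (d - (1 + ρ₀) / ‖K‖) * d := mul_pos (by linarith) hdpos
  have hmass : (∑ a ∈ S.erase v, ((D a : ℕ) : ℝ)) ≤ Nb := by
    refine le_trans ?_ hNb
    refine le_trans (Finset.sum_le_sum_of_subset_of_nonneg (Finset.erase_subset v S) fun u _ _ => Nat.cast_nonneg _) ?_
    exact Finset.sum_le_sum fun u _ => le_of_eq (hDcast u)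
  have hrN0 : 0 ≤ (1 + ρ₀) / ‖K‖ := le_trans (norm_nonneg _) hzvr
  have hcmp : (1 + ρ₀) / ‖K‖ * ((∑ a ∈ S.erase v, ((D a : ℕ) : ℝ)) / ((d - (1 + ρ₀) / ‖K‖) * d)) ≤
      (1 + ρ₀) / ‖K‖ * (Nb / ((d - (1 + ρ₀) / ‖K‖) * d)) :=
    mul_le_mul_of_nonneg_left (div_le_div_of_nonneg_right hmass hden.le) hrN0
  linarith

/-- ★★★★ THE FOURTH DOOR, ANALYTIC FORM (engine level): the isolated-strong-field regime of `AntiEscapeCore` from SCALAR + CONTAINMENT data only.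
`F = f^{(j)}`, `h = dslope F v`, CANONICAL FIELD `K = h′(v)/h(v) = F″(v)/(2F′(v))`; the Newton disc `‖z − (v − K⁻¹)‖ ≤ ρ₀/‖K‖` (`ρ₀ ≠ 1`) on which
`h` is zero-free, off the real axis, with slack; a Landau disc about a non-zero point `c` of `F` (`|F| ≤ Bd` on `‖z − c‖ ≤ Rb`, radii
`0 < r < r₁ < R₂ < Rb`, `v` simple and in the inner ball) whose open `r`-ball contains the `δ`-collar of a Lipschitz ball (radius `rL ≥ max(1,ρ₀)/‖K‖`)
about the Newton centre; isolation `d > r_N = (1+ρ₀)/‖K‖` of the other inner-ball zeros from `v`, their mass `≤ Nb`; `ε ≥` the Landau constant;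
END CONDITION `(1+ρ₀)·(r_N·Nb/((d − r_N)d) + (ε/δ)·r_N) < ρ₀‖K‖`.  THEN `v` has a successor.  All analysis is in this file; what a hand supplies
are the numbers (C2/C3 pricing at the engine scale). -/
theorem succ_of_newton_door_landau {η : ℝ} {f : ℂ → ℂ} {x₀ s hmax R Hs : ℝ} {B j : ℕ} {v : ℂ} (hE : EngineHyps5 2 η f x₀ s hmax R Hs B)
    (hv : StTrkDQ η f x₀ s hmax R Hs B j v)
    {K : ℂ} (hKdef : K = deriv (dslope (iteratedDeriv j f) v) v / dslope (iteratedDeriv j f) v v) (hK : K ≠ 0) (hKy : 1 < ‖K‖ * v.im)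
    {ρ₀ : ℝ} (hρ₀ : 0 < ρ₀) (hρ1 : ρ₀ ≠ 1) (hoff : ρ₀ / ‖K‖ ≤ |(v - K⁻¹).im|)
    (hh0 : ∀ z : ℂ, ‖z - (v - K⁻¹)‖ ≤ ρ₀ / ‖K‖ → dslope (iteratedDeriv j f) v z ≠ 0)
    {c : ℂ} {r r₁ R₂ Rb Bd rL δ d Nb ε : ℝ} (hr : 0 < r) (hr₁ : r < r₁) (hR₂ : r₁ < R₂) (hRb : R₂ < Rb)
    (hc : iteratedDeriv j f c ≠ 0) (hBd : ∀ z ∈ Metric.closedBall c Rb, ‖iteratedDeriv j f z‖ ≤ Bd)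
    (hvin : v ∈ Metric.closedBall c R₂) (hord : analyticOrderAt (iteratedDeriv j f) v = 1)
    (hδ : 0 < δ) (hrL1 : 1 / ‖K‖ ≤ rL) (hrL2 : ρ₀ / ‖K‖ ≤ rL)
    (hcont : Metric.closedBall (v - K⁻¹) (rL + δ) ⊆ Metric.ball c r)
    (hiso : ∀ u ∈ Metric.closedBall c R₂, iteratedDeriv j f u = 0 → u ≠ v → d ≤ ‖v - u‖) (hd : (1 + ρ₀) / ‖K‖ < d)
    (hNb : (∑ u ∈ nearSet (iteratedDeriv j f) c R₂, ((MeromorphicOn.divisor (iteratedDeriv j f) (Metric.closedBall c R₂)) u : ℝ)) ≤ Nb)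
    (hε : 2 * r₁ / ((R₂ - r₁) * (r₁ - r)) * (Real.log (Bd / ‖iteratedDeriv j f c‖) + Nb * Real.log (Rb / (Rb - R₂)) + 1) ≤ ε)
    (hend : (1 + ρ₀) * ((1 + ρ₀) / ‖K‖ * (Nb / ((d - (1 + ρ₀) / ‖K‖) * d)) + ε / δ * ((1 + ρ₀) / ‖K‖)) < ρ₀ * ‖K‖)
    (hslack : (rhoN x₀ R v + (1 + ρ₀) / ‖K‖) ^ 2 + ((j : ℝ) + 1) * (v.im + (1 + ρ₀) / ‖K‖) ^ 2 ≤ ((j : ℝ) + 1) * Hs ^ 2) :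
    ∃ u : ℂ, StTrkDQ η f x₀ s hmax R Hs B (j + 1) u := by
  have hFd : Differentiable ℂ (iteratedDeriv j f) := differentiable_iteratedDeriv_of_entire hE.1 j
  have hFan : AnalyticOnNhd ℂ (iteratedDeriv j f) (Metric.closedBall c Rb) := fun z _ => hFd.analyticAt z
  have hh : ContinuousAt (dslope (iteratedDeriv j f) v) v := (Literature.NumberTheory.LFunctions.BurnolVectors.differentiable_dslope hFd v v).continuousAt
  exact succ_of_newton_door_lip hE hv hK hKy hρ₀ hend hoff hh0
    (lipschitz_on_newton_circle hr hr₁ hR₂ hRb hFan hc hBd hvin hord (fun z => factor_dslope hv.2.1 z) hh hKdef hK hρ1 hh0 hδ hrL1 hrL2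
      hcont hiso hd hNb hε) hslack


end RhW08.NewtonDoor
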